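import Mathlib

/-!
# The number of distinct roots under specialisation

For a polynomial `f ∈ B[X]` over an integral domain `B` and ring homomorphisms ("specialisations")
`φ : B → Ω` into an algebraically closed field, the number `ρ(φ)` of distinct roots of `φ(f)` in `Ω`
is **lower semicontinuous** in the Zariski sense: there is `Δ ∈ B ∖ 0` such that `ρ(φ)` is maximal
(equal to the number of distinct roots of `f` over an algebraic closure of `Frac B`) whenever
`φ(Δ) ≠ 0` and `φ` does not kill the leading coefficient, while `ρ(ψ)` never exceeds that number
(`card_roots_toFinset_le_of_monic`, `card_roots_toFinset_le`). Classical references: the number of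
distinct roots is the rank of Hermite's / Sylvester's Hankel form of the power sums (Basu–Pollack–Roy,
*Algorithms in Real Algebraic Geometry*, §4.1), whose rank can only drop under specialisation; we give
the proof by extending specialisations to the roots (going up):

* `exists_ringHom_comp_algebraMap_eq` — **a homomorphism into an algebraically closed field extends
  along an integral ring extension** (`R → S` integral, `φ : R → Ω` killing `ker (R → S)`; lying-over
  plus `IsAlgClosed.lift`). [Atiyah–Macdonald, Thm 5.10 and Ex. 5.2]
* `card_roots_toFinset_le_of_monic_of_splits`, `card_roots_toFinset_le_of_monic` — the
  semicontinuity statement for monic `f`: adjoin the roots `r₁, …, r_ρ` of `f` (integral over `B`);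
  every specialisation extends to them, so `ψ(f)` has the roots `χ(rᵢ)` (at most `ρ` distinct ones),
  and `φ(f)` has exactly `ρ` distinct roots as soon as `χ(∏_{i ≠ j} (rᵢ - rⱼ)) ≠ 0`, which is
  guaranteed by `φ(Δ) ≠ 0` for the nonzero constant term `Δ` of an integral equation of
  `∏_{i ≠ j} (rᵢ - rⱼ)` over `B`.
* `card_roots_toFinset_integralNormalization` — `f` and its integral normalisation have the same
  number of distinct roots over a field (the roots are scaled by the leading coefficient);
* `card_roots_toFinset_le` — the statement for arbitrary `f`, at specialisations not killing the
  leading coefficient.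

## References

* [AtiyahMacdonald1969] M. F. Atiyah, I. G. Macdonald, *Introduction to Commutative Algebra* (1969),
  Thm 5.10 (lying over), Ex. 5.2 (extension of homomorphisms into algebraically closed fields).
* [Lang2002] S. Lang, *Algebra*, 3rd ed., GTM 211, Ch. VII §3, Prop. 3.1 (extension of homomorphisms
  along integral extensions), Ch. IV §8 (resultants and common roots).
-/

noncomputable section

open Polynomial

namespace Literature.RingTheory.Elimination

/-! ### Extending specialisations along integral extensions -/

/-- **Extension of homomorphisms along integral extensions** (Atiyah–Macdonald Ex. 5.2; Lang VII
Prop. 3.1): if `S` is integral over `R` and `φ : R → Ω` is a homomorphism into an algebraically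
closed field killing the kernel of `R → S`, then `φ` extends to `S`. (Lying over gives a prime `𝔓`
of `S` above `ker φ`; then `S ⧸ 𝔓` is an integral domain algebraic over `R ⧸ ker φ ↪ Ω`, and
`IsAlgClosed.lift` applies.) [cite: Lang2002, Ch. VII §3 Prop. 3.1] [cite: AtiyahMacdonald1969, Thm 5.10] -/
theorem exists_ringHom_comp_algebraMap_eq {R S Ω : Type*} [CommRing R] [CommRing S] [Algebra R S]
    [Algebra.IsIntegral R S] [Field Ω] [IsAlgClosed Ω] (φ : R →+* Ω)
    (hker : RingHom.ker (algebraMap R S) ≤ RingHom.ker φ) :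
    ∃ ψ : S →+* Ω, ψ.comp (algebraMap R S) = φ := by
  classical
  haveI : (RingHom.ker φ).IsPrime := RingHom.ker_isPrime φ
  obtain ⟨𝔓, -, h𝔓, hcomap⟩ := Ideal.exists_ideal_over_prime_of_isIntegral (RingHom.ker φ)
    (⊥ : Ideal S) (by rwa [← RingHom.ker_eq_comap_bot])
  haveI := h𝔓
  -- `φ` factors through the domain `R ⧸ 𝔭`, `𝔭 = 𝔓 ∩ R = ker φ`, injectively
  let φ' : R ⧸ 𝔓.comap (algebraMap R S) →+* Ω :=
    Ideal.Quotient.lift _ φ fun r hr => (hcomap ▸ hr : r ∈ RingHom.ker φ)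
  have hφ' : Function.Injective φ' := by
    rw [RingHom.injective_iff_ker_eq_bot, Ideal.ker_quotient_lift, hcomap, Ideal.map_quotient_self]
  letI : Algebra (R ⧸ 𝔓.comap (algebraMap R S)) Ω := φ'.toAlgebra
  haveI : IsDomain (S ⧸ 𝔓) := Ideal.Quotient.isDomain 𝔓
  haveI : IsDomain (R ⧸ 𝔓.comap (algebraMap R S)) := Ideal.Quotient.isDomain _
  haveI : Module.IsTorsionFree (R ⧸ 𝔓.comap (algebraMap R S)) (S ⧸ 𝔓) :=
    Module.isTorsionFree_iff_algebraMap_injective.2 Ideal.algebraMap_quotient_injective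
  haveI : Module.IsTorsionFree (R ⧸ 𝔓.comap (algebraMap R S)) Ω :=
    Module.isTorsionFree_iff_algebraMap_injective.2 hφ'
  haveI : Algebra.IsAlgebraic (R ⧸ 𝔓.comap (algebraMap R S)) (S ⧸ 𝔓) :=
    Algebra.IsIntegral.isAlgebraic
  let L : (S ⧸ 𝔓) →ₐ[R ⧸ 𝔓.comap (algebraMap R S)] Ω := IsAlgClosed.lift
  refine ⟨L.toRingHom.comp (Ideal.Quotient.mk 𝔓), ?_⟩
  ext r
  have h1 : Ideal.Quotient.mk 𝔓 (algebraMap R S r) =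
      algebraMap (R ⧸ 𝔓.comap (algebraMap R S)) (S ⧸ 𝔓) (Ideal.Quotient.mk _ r) := rfl
  have h2 : algebraMap (R ⧸ 𝔓.comap (algebraMap R S)) Ω (Ideal.Quotient.mk _ r) = φ r := rfl
  simp only [RingHom.comp_apply, AlgHom.toRingHom_eq_coe, RingHom.coe_coe, h1, AlgHom.commutes, h2]

/-! ### Semicontinuity of the number of distinct roots -/

section Roots

variable {B : Type*} [CommRing B] [IsDomain B] (Ω : Type*) [Field Ω] [IsAlgClosed Ω]
  [DecidableEq Ω]

/-- **Lower semicontinuity of the number of distinct roots, monic case, over a given splitting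
extension.** Let `f ∈ B[X]` be monic, `B → E` an injective homomorphism into a field over which `f`
splits. Then there is `Δ ∈ B ∖ 0` such that for all specialisations `φ ψ : B → Ω` into an
algebraically closed field with `φ(Δ) ≠ 0`, `ψ(f)` has at most as many distinct roots as `φ(f)`.
(Both specialisations extend to the `B`-algebra generated by the roots; `φ` then separates the
roots.) Folklore; the extension of specialisations is Lang, *Algebra*, VII §3 Prop. 3.1. [folklore] -/
theorem card_roots_toFinset_le_of_monic_of_splits {E : Type*} [Field E] [Algebra B E]
    [DecidableEq E] (hinj : Function.Injective (algebraMap B E)) {f : B[X]} (hf : f.Monic)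
    (hsplit : (f.map (algebraMap B E)).Splits) :
    ∃ Δ : B, Δ ≠ 0 ∧ ∀ φ ψ : B →+* Ω, φ Δ ≠ 0 →
      (f.map ψ).roots.toFinset.card ≤ (f.map φ).roots.toFinset.card := by
  classical
  have hfEm : (f.map (algebraMap B E)).Monic := hf.map _
  -- the distinct roots `D` of `f` in `E`, and the integral `B`-algebra `S` they generate
  obtain ⟨D, hD⟩ : ∃ D : Finset E, D = (f.map (algebraMap B E)).roots.toFinset := ⟨_, rfl⟩
  obtain ⟨S, hS⟩ : ∃ S : Subalgebra B E, S = Algebra.adjoin B (D : Set E) := ⟨_, rfl⟩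
  have hDS : ∀ r ∈ D, r ∈ S := fun r hr => hS ▸ Algebra.subset_adjoin hr
  haveI : Algebra.IsIntegral B S := by
    rw [hS]
    refine Algebra.IsIntegral.adjoin fun r hr => ⟨f, hf, ?_⟩
    rw [Finset.mem_coe, hD, Multiset.mem_toFinset, mem_roots hfEm.ne_zero, IsRoot.def,
      eval_map] at hr
    exact hr
  -- lifting the roots into `S`
  let lift : E → S := fun e => if h : e ∈ S then ⟨e, h⟩ else 0
  have hlift : ∀ r ∈ D, ((lift r : S) : E) = r := by
    intro r hr
    simp only [lift, dif_pos (hDS r hr)]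
  -- `f = ∏ (X - r)` over `S`
  have hfS : f.map (algebraMap B S) =
      (((f.map (algebraMap B E)).roots.map lift).map fun r => X - C r).prod := by
    apply Polynomial.map_injective (algebraMap S E) Subtype.val_injective
    rw [Polynomial.map_map, ← IsScalarTower.algebraMap_eq, Polynomial.map_multiset_prod,
      Multiset.map_map, Multiset.map_map]
    conv_lhs => rw [hsplit.eq_prod_roots_of_monic hfEm]
    congr 1
    refine Multiset.map_congr rfl fun r hr => ?_
    have hrD : r ∈ D := by rw [hD, Multiset.mem_toFinset]; exact hr
    simp only [Function.comp_apply, Polynomial.map_sub, map_X, map_C]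
    congr 2
    exact (hlift r hrD).symm
  -- roots of a specialisation extended to `S`
  have hroots : ∀ χ : S →+* Ω, (f.map (χ.comp (algebraMap B S))).roots =
      ((f.map (algebraMap B E)).roots.map lift).map χ := by
    intro χ
    rw [← Polynomial.map_map, hfS, Polynomial.map_multiset_prod, Multiset.map_map]
    have h : (Polynomial.map χ ∘ fun r : S => X - C r) = ((fun r : Ω => X - C r) ∘ (χ : S → Ω)) := by
      funext r
      simp
    rw [h, ← Multiset.map_map, roots_multiset_prod_X_sub_C]
  -- the product of the root differences and its integral equation over `B`
  obtain ⟨δ, hδ⟩ : ∃ δ : S, δ = ∏ p ∈ D.offDiag, (lift p.1 - lift p.2) := ⟨_, rfl⟩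
  have hδ0 : δ ≠ 0 := by
    rw [hδ, Finset.prod_ne_zero_iff]
    intro p hp h0
    rw [Finset.mem_offDiag] at hp
    apply hp.2.2
    rw [← hlift _ hp.1, ← hlift _ hp.2.1, sub_eq_zero.1 h0]
  obtain ⟨P, hPm, hPδ⟩ : IsIntegral B δ := Algebra.IsIntegral.isIntegral δ
  obtain ⟨Q, hPQ, hQX⟩ :=
    Polynomial.exists_eq_pow_rootMultiplicity_mul_and_not_dvd P hPm.ne_zero 0
  have hQδ : aeval δ Q = 0 := by
    have h : aeval δ P = 0 := hPδ
    rw [hPQ, map_mul, map_pow, map_sub, aeval_X, map_zero, map_zero, sub_zero] at h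
    exact (mul_eq_zero.1 h).resolve_left (pow_ne_zero _ hδ0)
  have hΔ0 : Q.coeff 0 ≠ 0 := by
    intro h0
    apply hQX
    rw [map_zero, sub_zero, X_dvd_iff]
    exact h0
  -- `Δ = -δ · Q₁(δ)` in `S`
  have hΔδ : algebraMap B S (Q.coeff 0) = -(δ * aeval δ Q.divX) := by
    have h := hQδ
    rw [← X_mul_divX_add Q, map_add, map_mul, aeval_X, aeval_C] at h
    exact eq_neg_of_add_eq_zero_right h
  refine ⟨Q.coeff 0, hΔ0, fun φ ψ hφΔ => ?_⟩
  -- extend both specialisations to `S`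
  have hkerS : RingHom.ker (algebraMap B S) = ⊥ := by
    rw [← RingHom.injective_iff_ker_eq_bot]
    intro b b' hb
    apply hinj
    rw [IsScalarTower.algebraMap_eq B S E, RingHom.comp_apply, RingHom.comp_apply, hb]
  obtain ⟨χφ, hχφ⟩ := exists_ringHom_comp_algebraMap_eq (S := S) φ (hkerS.le.trans bot_le)
  obtain ⟨χψ, hχψ⟩ := exists_ringHom_comp_algebraMap_eq (S := S) ψ (hkerS.le.trans bot_le)
  rw [← hχφ, ← hχψ, hroots, hroots, Multiset.map_map, Multiset.map_map,
    Multiset.toFinset_map, Multiset.toFinset_map, ← hD]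
  -- `ψ`-side: at most `#D` distinct roots; `φ`-side: exactly `#D`
  refine Finset.card_image_le.trans (le_of_eq ?_)
  symm
  refine Finset.card_image_of_injOn fun r hr s hs hrs => ?_
  by_contra hne
  have hmem : (r, s) ∈ D.offDiag := Finset.mem_offDiag.2 ⟨hr, hs, hne⟩
  have hdvd : (lift r - lift s) ∣ δ := hδ ▸ Finset.dvd_prod_of_mem _ hmem
  have hχδ : χφ δ ≠ 0 := by
    intro h0
    apply hφΔ
    rw [← hχφ, RingHom.comp_apply, hΔδ, map_neg, map_mul, h0, zero_mul, neg_zero]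
  apply hχδ
  obtain ⟨u, hu⟩ := hdvd
  simp only [Function.comp_apply] at hrs
  rw [hu, map_mul, map_sub, hrs, sub_self, zero_mul]

/-- **Lower semicontinuity of the number of distinct roots, monic case.** For a monic `f ∈ B[X]`
over a domain `B` there is `Δ ∈ B ∖ 0` such that for all specialisations `φ ψ : B → Ω` into an
algebraically closed field with `φ(Δ) ≠ 0`, `ψ(f)` has at most as many distinct roots as `φ(f)`.
[folklore] -/
theorem card_roots_toFinset_le_of_monic {f : B[X]} (hf : f.Monic) :
    ∃ Δ : B, Δ ≠ 0 ∧ ∀ φ ψ : B →+* Ω, φ Δ ≠ 0 →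
      (f.map ψ).roots.toFinset.card ≤ (f.map φ).roots.toFinset.card := by
  classical
  have hinj : Function.Injective
      (algebraMap B (AlgebraicClosure (FractionRing B))) := by
    rw [IsScalarTower.algebraMap_eq B (FractionRing B) (AlgebraicClosure (FractionRing B))]
    exact (algebraMap (FractionRing B) _).injective.comp (IsFractionRing.injective B _)
  exact card_roots_toFinset_le_of_monic_of_splits Ω hinj hf (IsAlgClosed.splits _)

omit [IsAlgClosed Ω] in
/-- Over a field, a polynomial and its integral normalisation (the monic polynomial whose roots are
the roots scaled by the leading coefficient) have the same number of distinct roots. [folklore] -/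
theorem card_roots_toFinset_integralNormalization (P : Polynomial Ω) :
    P.integralNormalization.roots.toFinset.card = P.roots.toFinset.card := by
  by_cases hP : P = 0
  · simp [hP]
  have ha0 : P.leadingCoeff ≠ 0 := leadingCoeff_ne_zero.2 hP
  rcases Nat.eq_zero_or_pos P.natDegree with hdeg | hdeg
  · -- constant polynomial: no roots on either side
    have hC : P = C (P.coeff 0) := eq_C_of_natDegree_eq_zero hdeg
    have hc0 : P.coeff 0 ≠ 0 := by
      intro h0; apply hP; rw [hC, h0, map_zero]
    rw [hC, integralNormalization_C hc0, roots_one, roots_C]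
    rfl
  have key : ∀ x : Ω, P.integralNormalization.eval (P.leadingCoeff * x) =
      P.leadingCoeff ^ (P.natDegree - 1) * P.eval x := fun x => by
    simpa using integralNormalization_eval₂_leadingCoeff_mul hdeg (RingHom.id Ω) x
  have hN0 : P.integralNormalization ≠ 0 := (monic_integralNormalization hP).ne_zero
  have himage : P.integralNormalization.roots.toFinset =
      P.roots.toFinset.image (fun x => P.leadingCoeff * x) := by
    ext y
    simp only [Multiset.mem_toFinset, mem_roots hN0, mem_roots hP, Finset.mem_image, IsRoot.def]
    constructor
    · intro hy
      refine ⟨P.leadingCoeff⁻¹ * y, ?_, by rw [mul_inv_cancel_left₀ ha0]⟩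
      have := key (P.leadingCoeff⁻¹ * y)
      rw [mul_inv_cancel_left₀ ha0, hy] at this
      exact (mul_eq_zero.1 this.symm).resolve_left (pow_ne_zero _ ha0)
    · rintro ⟨x, hx, rfl⟩
      rw [key, hx, mul_zero]
  rw [himage, Finset.card_image_of_injective _ (mul_right_injective₀ ha0)]

/-- **Lower semicontinuity of the number of distinct roots.** For `f ∈ B[X]` over a domain `B`
there is `Δ ∈ B ∖ 0` such that for all specialisations `φ ψ : B → Ω` into an algebraically closed
field not killing the leading coefficient of `f` and with `φ(Δ) ≠ 0`, `ψ(f)` has at most as many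
distinct roots as `φ(f)`. [folklore] -/
theorem card_roots_toFinset_le (f : B[X]) :
    ∃ Δ : B, Δ ≠ 0 ∧ ∀ φ ψ : B →+* Ω, φ f.leadingCoeff ≠ 0 → ψ f.leadingCoeff ≠ 0 → φ Δ ≠ 0 →
      (f.map ψ).roots.toFinset.card ≤ (f.map φ).roots.toFinset.card := by
  by_cases hf : f = 0
  · exact ⟨1, one_ne_zero, fun φ ψ hφ _ _ => absurd (by simp [hf]) hφ⟩
  obtain ⟨Δ, hΔ0, hΔ⟩ :=
    card_roots_toFinset_le_of_monic Ω (monic_integralNormalization hf)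
  refine ⟨Δ, hΔ0, fun φ ψ hφ hψ hφΔ => ?_⟩
  have h := hΔ φ ψ hφΔ
  rwa [← integralNormalization_map φ f hφ, ← integralNormalization_map ψ f hψ,
    card_roots_toFinset_integralNormalization, card_roots_toFinset_integralNormalization] at h

end Roots

end Literature.RingTheory.Elimination

end
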